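import Summits.Parity.GeneralizedHardyLittlewood.Theorems.GoldbachHeathBrownDispersionHeathBrownMorozUniformSigmaOneCoprime
import Summits.Parity.GeneralizedHardyLittlewood.Theorems.GoldbachHeathBrownDispersionHeathBrownMorozUniformClassDisplay104
import Summits.Parity.GeneralizedHardyLittlewood.Theorems.GoldbachHeathBrownDispersionHeathBrownMorozUniformClassTypeISqfree
import Literature.NumberTheory.Sieve.HeathBrownCubicLeadingA
import Literature.NumberTheory.Sieve.HeathBrownCubicPrimesProofs
import Literature.NumberTheory.Sieve.HeathBrownMorozClassLemma35
import Literature.NumberTheory.Sieve.HeathBrownCubicTypeIIFinal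
import HarnessLib

/-!
# Crux `HeathBrownMorozUniform` (stmt-Parity-19915): the class Lemma 3.9 `h39` is a THEOREM (Part A of line `parent-differencing`, def-free Theorems port)

Helper file (`--supports stmt-Parity-19915`) for the crux
`Summit.Parity.GeneralizedHardyLittlewood.Theses.GoldbachHeathBrownDispersion.HeathBrownMorozUniform`
(Heath-Brown–Moroz 2004, Theorem 2 for `x³ + 2y³`, finite-uniform form) of route
`route-Parity-GoldbachHeathBrownDispersion` (Line C, FRONTIER formalisation rung F-P1b).  **Nothing here bears on
Goldbach**: it is one input of ONE crux of the formalisation of a 2004 theorem.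

The tree reduces the crux to three class hypotheses (`heathBrownMorozUniform_of_classLemmas`, p544930): `h35` (class
Lemma 3.5 — the landed `CubicSieve.class_lemma_3_5`, p555871), `h39` (class Lemma 3.9: leading `e`-parts of the class
vs `κ_d·ℬ`) and `h310` (class Lemma 3.10, Type II).  The registered skeleton
`Cruxes/HeathBrownMorozUniform/Lines/parent_differencing.lean` (v6) PROVES `h39` in the kernel from the landed stub
theorems, but a `Cruxes` module is not importable from `Theorems/`; this file is the def-free port of that Part A,
so that the crux closer can quote `classH39_holds` by name.  Contents (proofs copied from the kernel-checked
skeleton; the statement-defs `ClassDisplay104`, `ClassLeadingDifferencing` unfolded verbatim):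

* **`classDisplay104_holds`** — S4b 0-ary: the CLASS display (10.4)
  `U_e(𝒜_cl) = (w(d)/d²)σ₀η²X²Σ₃ + O(M⁻¹η^{5/2}X²(log X)^c)` = the landed
  `classDisplay104_of_typeISqfreeSum_of_sigmaOneCoprime` (ghb-stub-display104-p1, p562472) applied to S4a
  (`classTypeISqfreeSum_holds`, the lead's landed `…ClassTypeISqfree`, p564731) and to the landed coprime singular sum `classSigmaOneCoprime`
  (ghb-stub-sigma1-p1, p560964);
* `abs_sub_le_of_mid`, `abs_sub_le_of_mid₁`, `const_rpow_mono`, `classWeight_div_sq_nonneg` — arithmetic glue;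
* **`classLeadingDifferencing_holds`** — EQ39, the differenced leading parts
  `|Û_e(𝒜_cl) − (w/d²)Û_e(𝒜)| ≤ C M⁻¹η^{5/2}X²(log X)^c`: the class display minus the parent's PROVED display
  (10.4) (`HeathBrown2001_display_10_4`), `σ₀` pinned by `HeathBrown2001_singularProduct_holds`;
* **`classH39_holds`** — `h39` VERBATIM as the second hypothesis of `heathBrownMorozUniform_of_classLemmas`:
  EQ39 plus `(w/d²)·`(the parent's PROVED Lemma 3.9, `HeathBrown2001_lemma_3_9_holds`), `κ_d = (w/d²)κ`
  (`classKappa_def`);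
* `classH35_lemma_holds` — `h35` VERBATIM (the first hypothesis), by name from `class_lemma_3_5`.

## References

* D. R. Heath-Brown, B. Z. Moroz, Proc. LMS (3) 88 (2004) 289–312: Lemma 3.1, Lemma 4.1, Prop. 4.2 (i).
  [cite: HeathBrownMoroz2004, Lemma 4.1]
* D. R. Heath-Brown, Acta Math. 186 (2001) 1–84: Lemma 3.5, Lemma 3.9, §10 (10.1)–(10.4).
  [cite: HeathBrownActa2001, Lemma 3.9 and §10 (10.4)]

## Tree search

All inputs are landed: `classDisplay104_of_typeISqfreeSum_of_sigmaOneCoprime` (`…ClassDisplay104`),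
`classSigmaOneCoprime` (`…SigmaOneCoprime`), `classTypeISqfreeSum_holds` (`…ClassTypeISqfree`, p564731),
`HeathBrown2001_display_10_4` (`HeathBrownCubicLeadingA`), `HeathBrown2001_lemma_3_9_holds`,
`HeathBrown2001_singularProduct_holds`, `class_lemma_3_5` (`HeathBrownMorozClassLemma35`), `classKappa_def`,
`classWeight_pos`.  `lean search 'classH39'` in `Theorems/` + `Literature/`: none (only the Cruxes skeleton).
-/

noncomputable section

open Polynomial NumberField Finset Filter Topology Asymptotics

namespace Summit.Parity.GeneralizedHardyLittlewood.Theorems.GoldbachHeathBrownDispersionHeathBrownMorozUniform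

open Literature.NumberTheory.Sieve.CubicSieve Literature.NumberTheory.Sieve.CubicPrimes
open Literature.NumberTheory.LFunctions.CubeRootTwoField

/-! ### S4b, 0-ary: the class display (10.4) -/

/-- **S4b, 0-ary form:** the class display (10.4) `U_e(𝒜_cl) = (w/d²)σ₀η²X²Σ₃ + O(M⁻¹η^{5/2}X²(log X)^c)` for every
reduced admissible class, every limit `σ₀` of the singular product and every `ϖ ∈ (0, 1/5)` — the landed
`classDisplay104_of_typeISqfreeSum_of_sigmaOneCoprime` applied to S4a (`classTypeISqfreeSum_holds`) and to the landed
coprime-restricted singular sum `classSigmaOneCoprime`. [cite: HeathBrownActa2001, §10 (10.4)]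
[cite: HeathBrownMoroz2004, Lemma 4.1] -/
theorem classDisplay104_holds :
    ∀ d a b : ℕ, 0 < d → a < d → b < d → Nat.Coprime (a ^ 3 + 2 * b ^ 3) d →
      ∀ σ₀ : ℝ, Tendsto singularProductPartial atTop (𝓝 σ₀) → ∀ ϖ : ℝ, 0 < ϖ → ϖ < 1 / 5 →
        ∃ c C X₀ : ℝ, ∀ X η : ℝ, X₀ ≤ X → Real.exp (-Real.log X ^ (1 / 3 : ℝ)) ≤ η → η ≤ 1 →
          ∀ (k : ℕ) (m : Fin k → ℕ), CoreAdmissible (hbTau ϖ X) m →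
            ∀ cR : Ideal (𝓞 K) → ℝ, CSupport X (hbTau ϖ X) cR →
              |bilin (classPairs X η d a b) pairIdeal cR (eWeight X (hbTau ϖ X) m) -
                  classWeight d / (d : ℝ) ^ 2 * (σ₀ * η ^ 2 * X ^ 2 * sigma3 X (hbTau ϖ X) m cR)| ≤
                C * (∏ i, (m i : ℝ))⁻¹ * η ^ (5 / 2 : ℝ) * X ^ 2 * Real.log X ^ c :=
  classDisplay104_of_typeISqfreeSum_of_sigmaOneCoprime classTypeISqfreeSum_holds classSigmaOneCoprime

/-! ### Arithmetic glue -/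

/-- The triangle inequality through the scaled parent: `|A − wκB| ≤ |A − wP| + w|P − κB|` for `w ≥ 0`.
[folklore] -/
theorem abs_sub_le_of_mid {A P B w κ : ℝ} (hw : 0 ≤ w) :
    |A - w * κ * B| ≤ |A - w * P| + w * |P - κ * B| := by
  have h := abs_sub_le A (w * P) (w * κ * B)
  have e : w * P - w * κ * B = w * (P - κ * B) := by ring
  rw [e, abs_mul, abs_of_nonneg hw] at h
  exact h

/-- `|A − wB| ≤ |A − wP| + w|P − B|` for `w ≥ 0` (class (10.4) vs the scaled parent (10.4)). [folklore] -/
theorem abs_sub_le_of_mid₁ {A P B w : ℝ} (hw : 0 ≤ w) :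
    |A - w * B| ≤ |A - w * P| + w * |P - B| := by
  have h := abs_sub_le A (w * P) (w * B)
  have e : w * P - w * B = w * (P - B) := by ring
  rw [e, abs_mul, abs_of_nonneg hw] at h
  exact h

/-- Merging two power-of-log bounds: `C·F·L^c ≤ |C|·F·L^{c'}` for `F ≥ 0`, `L ≥ 1`, `c ≤ c'`
(`F = M⁻¹η^{5/2}X²` written as three factors). [folklore] -/
theorem const_rpow_mono {C M E X2 L c c' : ℝ} (hM : 0 ≤ M) (hE : 0 ≤ E) (hX : 0 ≤ X2) (hL : 1 ≤ L)
    (hc : c ≤ c') : C * M * E * X2 * L ^ c ≤ |C| * M * E * X2 * L ^ c' := by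
  have h1 : 0 ≤ L ^ c := Real.rpow_nonneg (by linarith) _
  have h2 : L ^ c ≤ L ^ c' := Real.rpow_le_rpow_of_exponent_le hL hc
  have hF : 0 ≤ M * E * X2 := mul_nonneg (mul_nonneg hM hE) hX
  have e1 : C * M * E * X2 * L ^ c = C * (M * E * X2) * L ^ c := by ring
  have e2 : |C| * M * E * X2 * L ^ c' = |C| * (M * E * X2) * L ^ c' := by ring
  rw [e1, e2]
  calc C * (M * E * X2) * L ^ c ≤ |C| * (M * E * X2) * L ^ c :=
        mul_le_mul_of_nonneg_right (mul_le_mul_of_nonneg_right (le_abs_self C) hF) h1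
    _ ≤ |C| * (M * E * X2) * L ^ c' := mul_le_mul_of_nonneg_left h2 (mul_nonneg (abs_nonneg C) hF)

/-- `w(d)/d² ≥ 0`. [cite: HeathBrownMoroz2004, (3.1)] -/
theorem classWeight_div_sq_nonneg (d : ℕ) : 0 ≤ classWeight d / (d : ℝ) ^ 2 :=
  div_nonneg (classWeight_pos d).le (pow_nonneg (Nat.cast_nonneg d) 2)

/-! ### EQ39 and the class Lemma 3.9 `h39` -/

/-- **EQ39 — the differenced leading parts**, from the class display (10.4) (`classDisplay104_holds`) and the
parent's display (10.4) (tree: `HeathBrown2001_display_10_4`):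
`Û_e(𝒜_cl) − (w/d²)Û_e(𝒜) = [Û_e(𝒜_cl) − (w/d²)σ₀η²X²Σ₃] − (w/d²)[Û_e(𝒜) − σ₀η²X²Σ₃]`, `σ₀` from
`HeathBrown2001_singularProduct_holds`; exponents merged to `max c₁ c₂` (`log X ≥ 1` for `X ≥ e`), constants
`|C₁| + (w/d²)|C₂|`. [cite: HeathBrownActa2001, §10 (10.4)] [cite: HeathBrownMoroz2004, Lemma 4.1] -/
theorem classLeadingDifferencing_holds :
    ∀ d a b : ℕ, 0 < d → a < d → b < d → Nat.Coprime (a ^ 3 + 2 * b ^ 3) d →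
      ∀ ϖ : ℝ, 0 < ϖ → ϖ < 1 / 5 →
        ∃ c C X₀ : ℝ, ∀ X η : ℝ, X₀ ≤ X → Real.exp (-Real.log X ^ (1 / 3 : ℝ)) ≤ η → η ≤ 1 →
          ∀ (k : ℕ) (m : Fin k → ℕ), CoreAdmissible (hbTau ϖ X) m →
            ∀ cR : Ideal (𝓞 K) → ℝ, CSupport X (hbTau ϖ X) cR →
              |bilin (classPairs X η d a b) pairIdeal cR (eWeight X (hbTau ϖ X) m) -
                  classWeight d / (d : ℝ) ^ 2 *
                    bilin (boxPairs X η) pairIdeal cR (eWeight X (hbTau ϖ X) m)| ≤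
                C * (∏ i, (m i : ℝ))⁻¹ * η ^ (5 / 2 : ℝ) * X ^ 2 * Real.log X ^ c := by
  intro d a b hd ha hb hadm ϖ hϖ0 hϖ5
  obtain ⟨σ₀, -, hσ⟩ := HeathBrown2001_singularProduct_holds
  obtain ⟨c₁, C₁, X₁, h₁⟩ := classDisplay104_holds d a b hd ha hb hadm σ₀ hσ ϖ hϖ0 hϖ5
  obtain ⟨c₂, C₂, X₂, h₂⟩ := HeathBrown2001_display_10_4 σ₀ hσ ϖ hϖ0 hϖ5
  have hw := classWeight_div_sq_nonneg d
  refine ⟨max c₁ c₂, |C₁| + classWeight d / (d : ℝ) ^ 2 * |C₂|, max (max X₁ X₂) (Real.exp 1), ?_⟩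
  intro X η hX hη hη1 k m hm cR hcR
  have hX1 : X₁ ≤ X := (le_max_left _ _).trans ((le_max_left _ _).trans hX)
  have hX2 : X₂ ≤ X := (le_max_right _ _).trans ((le_max_left _ _).trans hX)
  have hXe : Real.exp 1 ≤ X := (le_max_right _ _).trans hX
  have hlog : 1 ≤ Real.log X := by
    have h := Real.log_le_log (Real.exp_pos 1) hXe
    rwa [Real.log_exp] at h
  have hη0 : 0 ≤ η := (Real.exp_pos _).le.trans hη
  have hM : 0 ≤ (∏ i, (m i : ℝ))⁻¹ := inv_nonneg.2 (prod_nonneg fun i _ => Nat.cast_nonneg _)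
  have hE : 0 ≤ η ^ (5 / 2 : ℝ) := Real.rpow_nonneg hη0 _
  have hX2' : 0 ≤ X ^ 2 := sq_nonneg X
  have e₁ := h₁ X η hX1 hη hη1 k m hm cR hcR
  have e₂ := h₂ X η hX2 hη hη1 k m hm cR hcR
  rw [abs_sub_comm] at e₂
  refine (abs_sub_le_of_mid₁
    (P := σ₀ * η ^ 2 * X ^ 2 * sigma3 X (hbTau ϖ X) m cR) hw).trans ?_
  refine (add_le_add (e₁.trans (const_rpow_mono hM hE hX2' hlog (le_max_left c₁ c₂)))
    (mul_le_mul_of_nonneg_left (e₂.trans (const_rpow_mono hM hE hX2' hlog (le_max_right c₁ c₂)))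
      hw)).trans_eq ?_
  ring

/-- **The class Lemma 3.9 `h39` of Heath-Brown–Moroz (Prop. 4.2 (i): leading `e`-parts of the class vs `κ_d·ℬ`)
is a THEOREM** — VERBATIM the second hypothesis of `heathBrownMorozUniform_of_classLemmas`: EQ39
(`classLeadingDifferencing_holds`) plus `(w/d²)·`[the parent's PROVED Lemma 3.9, `HeathBrown2001_lemma_3_9_holds`],
`Û_e(𝒜_cl) − κ_d Û(ℬ) = [Û_e(𝒜_cl) − (w/d²)Û_e(𝒜)] + (w/d²)[Û_e(𝒜) − κÛ(ℬ)]`, `κ_d = (w/d²)κ` (`classKappa_def`);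
exponents merged to `max c₁ c₂` using `log X ≥ 1` (`X₀ ≥ e`), constants `|C₁| + (w/d²)|C₂|`.
[cite: HeathBrownMoroz2004, Proposition 4.2 and Lemma 4.1] [cite: HeathBrownActa2001, Lemma 3.9] -/
theorem classH39_holds :
    ∀ d a b : ℕ, 0 < d → a < d → b < d → Nat.Coprime (a ^ 3 + 2 * b ^ 3) d →
      ∀ σ₀ : ℝ, Tendsto singularProductPartial atTop (𝓝 σ₀) → ∀ ϖ : ℝ, 0 < ϖ → ϖ < 1 / 5 →
        ∃ c C X₀ : ℝ, ∀ X η : ℝ, X₀ ≤ X → Real.exp (-Real.log X ^ (1 / 3 : ℝ)) ≤ η → η ≤ 1 →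
          ∀ (k : ℕ) (m : Fin k → ℕ), CoreAdmissible (hbTau ϖ X) m →
            ∀ cR : Ideal (𝓞 K) → ℝ, CSupport X (hbTau ϖ X) cR →
              |bilin (classPairs X η d a b) pairIdeal cR (eWeight X (hbTau ϖ X) m) -
                  classKappa σ₀ X η d *
                    bilin (normWindow X η) (fun J => J) cR (dWeight X (hbTau ϖ X) m)| ≤
                C * (∏ i, (m i : ℝ))⁻¹ * η ^ (5 / 2 : ℝ) * X ^ 2 * Real.log X ^ c := by
  intro d a b hd ha hb hadm σ₀ hσ ϖ hϖ0 hϖ5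
  obtain ⟨c₁, C₁, X₁, h₁⟩ := classLeadingDifferencing_holds d a b hd ha hb hadm ϖ hϖ0 hϖ5
  obtain ⟨c₂, C₂, X₂, h₂⟩ := HeathBrown2001_lemma_3_9_holds σ₀ hσ ϖ hϖ0 hϖ5
  have hw := classWeight_div_sq_nonneg d
  refine ⟨max c₁ c₂, |C₁| + classWeight d / (d : ℝ) ^ 2 * |C₂|, max (max X₁ X₂) (Real.exp 1), ?_⟩
  intro X η hX hη hη1 k m hm cR hcR
  have hX1 : X₁ ≤ X := (le_max_left _ _).trans ((le_max_left _ _).trans hX)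
  have hX2 : X₂ ≤ X := (le_max_right _ _).trans ((le_max_left _ _).trans hX)
  have hXe : Real.exp 1 ≤ X := (le_max_right _ _).trans hX
  have hlog : 1 ≤ Real.log X := by
    have h := Real.log_le_log (Real.exp_pos 1) hXe
    rwa [Real.log_exp] at h
  have hη0 : 0 ≤ η := (Real.exp_pos _).le.trans hη
  have hM : 0 ≤ (∏ i, (m i : ℝ))⁻¹ := inv_nonneg.2 (prod_nonneg fun i _ => Nat.cast_nonneg _)
  have hE : 0 ≤ η ^ (5 / 2 : ℝ) := Real.rpow_nonneg hη0 _
  have hX2' : 0 ≤ X ^ 2 := sq_nonneg X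
  have e₁ := h₁ X η hX1 hη hη1 k m hm cR hcR
  have e₂ := h₂ X η hX2 hη hη1 k m hm cR hcR
  simp only [classKappa_def]
  refine (abs_sub_le_of_mid
    (P := bilin (boxPairs X η) pairIdeal cR (eWeight X (hbTau ϖ X) m)) hw).trans ?_
  refine (add_le_add (e₁.trans (const_rpow_mono hM hE hX2' hlog (le_max_left c₁ c₂)))
    (mul_le_mul_of_nonneg_left (e₂.trans (const_rpow_mono hM hE hX2' hlog (le_max_right c₁ c₂)))
      hw)).trans_eq ?_
  ring

/-- **The class Lemma 3.5 `h35`** (first hypothesis of `heathBrownMorozUniform_of_classLemmas`, VERBATIM) — by name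
from the landed `CubicSieve.class_lemma_3_5` (p555871). [cite: HeathBrownMoroz2004, Lemma 3.1]
[cite: HeathBrownActa2001, Lemma 3.5] -/
theorem classH35_lemma_holds :
    ∀ d a b : ℕ, 0 < d → a < d → b < d → Nat.Coprime (a ^ 3 + 2 * b ^ 3) d →
      ∀ σ₀ : ℝ, Tendsto singularProductPartial atTop (𝓝 σ₀) → ∀ ϖ : ℝ, 0 < ϖ → ϖ < 1 / 5 →
        ∃ C X₀ : ℝ, ∀ X η : ℝ, X₀ ≤ X → Real.exp (-Real.log X ^ (1 / 3 : ℝ)) ≤ η → η ≤ 1 →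
          ∑ n ∈ range (chainBound (hbTau ϖ X) + 1),
              |(Tpiece (classPairs X η d a b) pairIdeal X (hbTau ϖ X) n : ℝ) -
                  classKappa σ₀ X η d * Tpiece (normWindow X η) (fun J => J) X (hbTau ϖ X) n| ≤
            C * hbTau ϖ X * η ^ 2 * X ^ 2 / Real.log X :=
  fun _d _a _b hd ha hb hadm σ₀ hσ ϖ hϖ0 hϖ5 => class_lemma_3_5 hd ha hb hadm σ₀ hσ ϖ hϖ0 hϖ5

end Summit.Parity.GeneralizedHardyLittlewood.Theorems.GoldbachHeathBrownDispersionHeathBrownMorozUniform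

end
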